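import Summits.HodgeConjecture.HodgeConjecture.Theorems.LimitExtensionSpecialisationOfAlgebraicityOfLocalSpread
import Literature.AlgebraicGeometry.HodgeTheory.SpreadSupportsOverCurve

/-!
# Route LimitExtension — `SpecialisationOfAlgebraicity` (item stmt-HodgeConjecture-2998), quasi-projective total space, from the named spreading fact

`map_comp_fiberι_mem_supportedClasses_one_of_isQuasiProjectiveOver` — the conclusion of the
support item `SpecialisationOfAlgebraicity` for every family `f : W ⟶ T` of the item WITH `W`
QUASI-PROJECTIVE over `ℂ` (the case of the route's intended families: pencils of hypersurfaces,
restrictions of the universal hypersurface to a curve — all projective over the base), granted the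
named fact `HodgeTheory.spread_supports_over_smoothCurve` (spreading of fibrewise algebraic
supports over a smooth curve: relative Hilbert schemes of the projective morphism `f|_{T ∖ t₀}`,
Voisin II §3.3.1 / proof of Thm. 10.19, Charles–Schnell proof of Prop. 11.3.11). Proof: the fact
with `S = {t₀}` (a closed point; `≠ T` since the curve `T` has dimension `1`) is exactly the local
spread data consumed by `map_comp_fiberι_mem_supportedClasses_one_of_localSpread`.

The item as filed has `f` merely flat and proper; for it the same reduction is
`specialisationOfAlgebraicity_of_localSpread`, whose hypothesis is the fact's conclusion without
the quasi-projectivity clause (Chow's lemma / Hilbert algebraic spaces; not printed).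
-/

noncomputable section

-- `Summit.HodgeConjecture.HodgeConjecture.Theorems` is the mandated namespace (single-conjunct summit:
-- Sub = Summit), which `linter.dupNamespace` flags on every declaration; the lakefile turns the
-- linter off tree-wide (weak option), restated here so stand-alone elaboration is warning-free too.
set_option linter.dupNamespace false

open Set Function

namespace Summit.HodgeConjecture.HodgeConjecture.Theorems

section QuasiProjective

open CategoryTheory AlgebraicGeometry Order
open Literature.AlgebraicGeometry.Motives Literature.AlgebraicGeometry.HodgeTheory

/-- On a smooth irreducible curve the closed point under a complex point is not the whole curve
(the generic point has height `1`, a closed point height `0`). [folklore] -/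
theorem singleton_pt_ne_univ_of_smoothCurve {T : SchemeOver ℂ} (hT : SmoothOfRelativeDimension 1 T.hom)
    [IrreducibleSpace T.left] (t₀ : ComplexPoints T) : ({t₀.pt} : Set T.left) ≠ Set.univ := by
  haveI := hT
  haveI : Smooth T.hom := SmoothOfRelativeDimension.smooth 1 T.hom
  haveI : IsReduced T.left := isReduced_of_smooth_over_field T.hom
  haveI : IsIntegral T.left := isIntegral_of_irreducibleSpace_of_isReduced T.left
  intro h
  have htop : (⊤ : T.left) ∈ ({t₀.pt} : Set T.left) := h ▸ Set.mem_univ _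
  have h1 := height_top_eq_one_of_smoothCurve (T := T)
  rw [Set.mem_singleton_iff.1 htop] at h1
  -- a closed point has height `0`
  have h0 : height t₀.pt = 0 := by
    refine Order.height_eq_zero.mpr fun y hy => ?_
    have hxy : t₀.pt ⤳ y := Scheme.le_iff_specializes.mp hy
    have hmem : y ∈ closure ({t₀.pt} : Set T.left) := specializes_iff_mem_closure.mp hxy
    rw [t₀.isClosed_pt.closure_eq, Set.mem_singleton_iff] at hmem
    exact le_of_eq hmem.symm
  rw [h0] at h1
  exact zero_ne_one h1

/-- **Item stmt-HodgeConjecture-2998 for quasi-projective `W`, from the named spreading fact.**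
Let `k ≥ 1`, `X` smooth projective of dimension `2k`, `T` a smooth irreducible complex curve,
`f : W ⟶ T` flat and proper with `W` QUASI-PROJECTIVE over `ℂ`, `g : X ⟶ W_{t₀}` an open
immersion on a non-empty open `U ⊆ X`, and `B ∈ H^{2k}(W(ℂ); ℂ)` such that for all `t ≠ t₀` the
fibre `W_t` is smooth projective of dimension `2k` and `B|_{W_t}` is algebraic. Then
`(g ≫ ι_{t₀})^* B ∈ N¹ H^{2k}(X(ℂ); ℂ)` — granted `HodgeTheory.spread_supports_over_smoothCurve`:
applied with `S = {t₀}` it yields a Zariski-closed `𝒵 ⊆ W` with slices of dimension `≤ k`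
pointwise and a proper closed `S' ∋ t₀` off which the `B_t` die off `𝒵_t`, i.e. the local spread
data of `map_comp_fiberι_mem_supportedClasses_one_of_localSpread`.
[cite: VoisinHodgeII2003, §3.3.1 and §10.2.1 (proof of Thm. 10.19)]
[cite: Fulton1998, §10.1 and §20.3] -/
theorem map_comp_fiberι_mem_supportedClasses_one_of_isQuasiProjectiveOver
    (hF : spread_supports_over_smoothCurve) {k : ℕ} {X T W : SchemeOver ℂ} (f : W ⟶ T)
    (t₀ : ComplexPoints T) (g : X ⟶ fiberOver f t₀) (B : complexBetti W (2 * k)) (hk : 0 < k)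
    (hX : IsSmoothProjective (2 * k) X) (hT : SmoothOfRelativeDimension 1 T.hom)
    [IrreducibleSpace T.left] (hW : IsQuasiProjectiveOver W) (hflat : Flat f.left)
    (hprop : IsProper f.left)
    (hU : ∃ U : X.left.Opens, (U : Set X.left).Nonempty ∧ IsOpenImmersion (U.ι ≫ g.left))
    (hfib : ∀ t : ComplexPoints T, t ≠ t₀ → IsSmoothProjective (2 * k) (fiberOver f t) ∧
      complexBetti.map (fiberι f t) (2 * k) B ∈ algebraicClasses (fiberOver f t) k) :
    complexBetti.map (g ≫ fiberι f t₀) (2 * k) B ∈ supportedClasses X (2 * k) 1 := by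
  have hne : ∀ t : ComplexPoints T, t.pt ∉ ({t₀.pt} : Set T.left) → t ≠ t₀ := fun t ht h =>
    ht (h ▸ Set.mem_singleton _)
  obtain ⟨𝒵, h𝒵, hdim, S', hS', hSS', hS'ne, hdies⟩ := hF f hT ‹_› hW hflat hprop hk (by omega)
    {t₀.pt} t₀.isClosed_pt (singleton_pt_ne_univ_of_smoothCurve hT t₀)
    (fun t ht => (hfib t (hne t ht)).1) B (fun t ht => (hfib t (hne t ht)).2)
  exact map_comp_fiberι_mem_supportedClasses_one_of_localSpread f t₀ g B hk hX hT hflat hprop hU h𝒵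
    (fun m hm => hdim t₀ m hm) hS' hS'ne hdies

end QuasiProjective

end Summit.HodgeConjecture.HodgeConjecture.Theorems

end
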